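import Summits.Ventures.HodgeKum4.Theorems.KummerFixedLocusHilbertKummerTransferCover
import HarnessLib

/-!
# V0 (`HilbertKummerTransfer`) — degree bookkeeping through the Künneth isomorphism: `Θ^*` of a class of degree `k`
# lies in `κ(H*(A) ⊗ R_{≤ k})` (cell `hodge-kum4`, lane (V), seat p2)

Route `KummerFixedLocus`, item `HilbertKummerTransfer` (stmt-Ventures-20354).  HONEST FRAMING: helper theorems;
nothing about V0, L1 or the Hodge conjecture is proved in this file.

For Beauville's cover `Θ : A × K ⟶ H` (Galois datum as in `…Cover`), `R = fibreRange = im θ^*`: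
* `exists_homogeneous_expansion` — finitely many HOMOGENEOUS classes `mᵢ` of `H*(A(ℂ); ℂ) = ⨁ₐ Hᵃ` and homogeneous
  functionals `φᵢ` (`φᵢ ∘ h_A = (a - 2) φᵢ`) with `t = Σᵢ mᵢ ⊗ (φᵢ ⊗ id) t` for every tensor `t`;
* `degreeOperator_contract` — if `t ∈ H*(A) ⊗ H*(K)` is an eigenvector of the total degree operator and `φ` is a
  homogeneous functional, the contraction `(φ ⊗ id) t` is homogeneous of the complementary degree;
* `exists_totalPullback_ofDegree_eq_of_mem_range` — a homogeneous class of `R = im θ^*` of degree `d` is `θ^*` of a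
  class of degree `d`;
* **`totalPullback_ofDegree_mem_map_tensorWith`** — for `z ∈ Hᵏ(H(ℂ))` and any submodule `S ⊆ H*(K)` containing
  `θ^*(Hᵈ(H))` for all `d ≤ k`: `Θ^*(z) ∈ κ(H*(A) ⊗ S)` (expand `κ⁻¹ Θ^* z = Σᵢ bᵢ ⊗ sᵢ` in a homogeneous basis: each
  `sᵢ ∈ R` is homogeneous of degree `k - deg bᵢ ≤ k`).
-/

noncomputable section

open CategoryTheory MonoidalCategory CartesianMonoidalCategory DirectSum TensorProduct
open Literature.AlgebraicTopology.SingularHomology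
open Literature.AlgebraicGeometry Literature.AlgebraicGeometry.Motives Literature.AlgebraicGeometry.Hyperkaehler
open Literature.AlgebraicGeometry.HilbertScheme Literature.AlgebraicGeometry.HodgeTheory
open Literature.Algebra.Lie (degreeSpace)

namespace Summit.Ventures.HodgeKum4.HilbertKummer

open scoped MonObj

/-! ### A homogeneous expansion `t = Σᵢ mᵢ ⊗ (φᵢ ⊗ id) t` with homogeneous `mᵢ`, `φᵢ` -/

/-- Components of `h v`: `(h_N v)_a = (a - N) • v_a`. -/
theorem component_degreeOperator {Y : Type} [TopologicalSpace Y] (N a : ℕ) (v : totalCohomology ℂ Y) :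
    DirectSum.component ℂ ℕ (fun i ↦ (singularCohomology ℂ ℂ Y i : Type)) a (degreeOperator ℂ Y N v) =
      (((a : ℂ) - N)) • DirectSum.component ℂ ℕ (fun i ↦ (singularCohomology ℂ ℂ Y i : Type)) a v := by
  classical
  induction v using DirectSum.induction_on with
  | zero => simp only [map_zero, smul_zero]
  | add x y hx hy => simp only [map_add, hx, hy, smul_add]
  | of i x =>
    rw [← lof_eq_of ℂ]
    change DirectSum.component ℂ ℕ _ a (degreeOperator ℂ Y N (ofDegree ℂ Y i x)) = _
    rw [degreeOperator_lof, map_smul]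
    by_cases hia : i = a
    · subst hia; rfl
    · rw [DirectSum.component.of (R := ℂ) (M := fun i ↦ (singularCohomology ℂ ℂ Y i : Type)), dif_neg hia,
        smul_zero, smul_zero]

/-- `v = Σ_{a ≤ 2m} v_a` on `H*(X(ℂ))` for `X` smooth projective of dimension `m`. -/
theorem eq_sum_ofDegree_component {X : SchemeOver ℂ} {m : ℕ} (hX : IsSmoothProjective m X)
    (v : totalCohomology ℂ (ComplexPoints X)) :
    v = ∑ a : Fin (2 * m + 1), ofDegree ℂ (ComplexPoints X) (a : ℕ)
      (DirectSum.component ℂ ℕ (fun i ↦ (complexBetti X i : Type)) (a : ℕ) v) := by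
  classical
  refine (bijective_pi_component hX).1 (funext fun k ↦ ?_)
  simp only [LinearMap.pi_apply, map_sum]
  rw [Finset.sum_eq_single k]
  · exact (DirectSum.component.lof_self (R := ℂ) (M := fun i ↦ (complexBetti X i : Type)) _ _).symm
  · intro b _ hbk
    rw [DirectSum.component.of (R := ℂ) (M := fun i ↦ (complexBetti X i : Type)), dif_neg]
    exact fun h ↦ hbk (Fin.ext h)
  · simp

/-- **A homogeneous expansion**: for `X` smooth projective there are finitely many homogeneous classes
`mᵢ ∈ H^{deg i}(X(ℂ))` and homogeneous functionals `φᵢ` (`φᵢ ∘ h_N = (deg i - N) • φᵢ`) with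
`t = Σᵢ mᵢ ⊗ (φᵢ ⊗ id) t` for every tensor `t` (take bases of the `Hᵃ`, `a ≤ 2 dim X`, and their coordinate
functionals composed with the projections `v ↦ v_a`). -/
theorem exists_homogeneous_expansion {X : SchemeOver ℂ} {m : ℕ} (hX : IsSmoothProjective m X) (N : ℕ)
    (W : Type) [AddCommGroup W] [Module ℂ W] :
    ∃ (I : Type) (_ : Fintype I) (b : I → totalCohomology ℂ (ComplexPoints X))
      (φ : I → Module.Dual ℂ (totalCohomology ℂ (ComplexPoints X))) (deg : I → ℕ),
      (∀ i, ∃ y : complexBetti X (deg i), b i = ofDegree ℂ (ComplexPoints X) (deg i) y) ∧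
      (∀ i, φ i ∘ₗ degreeOperator ℂ (ComplexPoints X) N = (((deg i : ℂ) - N)) • φ i) ∧
      (∀ t : totalCohomology ℂ (ComplexPoints X) ⊗[ℂ] W, ∑ i, b i ⊗ₜ contract W (φ i) t = t) := by
  classical
  haveI := fun a ↦ finite_complexBetti hX a
  let β : ∀ a : ℕ, Module.Basis (Module.Free.ChooseBasisIndex ℂ (complexBetti X a)) ℂ (complexBetti X a) :=
    fun a ↦ Module.Free.chooseBasis ℂ _
  let cmp : ∀ a : ℕ, totalCohomology ℂ (ComplexPoints X) →ₗ[ℂ] complexBetti X a :=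
    fun a ↦ DirectSum.component ℂ ℕ (fun i ↦ (complexBetti X i : Type)) a
  refine ⟨Σ a : Fin (2 * m + 1), Module.Free.ChooseBasisIndex ℂ (complexBetti X a), inferInstance,
    fun i ↦ ofDegree ℂ (ComplexPoints X) i.1 (β i.1 i.2), fun i ↦ (β i.1).coord i.2 ∘ₗ cmp i.1, fun i ↦ i.1,
    fun i ↦ ⟨_, rfl⟩, fun i ↦ ?_, fun t ↦ ?_⟩
  · refine LinearMap.ext fun v ↦ ?_
    simp only [LinearMap.coe_comp, Function.comp_apply, LinearMap.smul_apply, cmp, component_degreeOperator, map_smul]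
  · induction t using TensorProduct.induction_on with
    | zero => simp
    | add x y hx hy =>
      conv_rhs => rw [← hx, ← hy, ← Finset.sum_add_distrib]
      exact Finset.sum_congr rfl fun i _ ↦ by rw [map_add, tmul_add]
    | tmul v w =>
      simp only [contract_tmul, LinearMap.coe_comp, Function.comp_apply, tmul_smul, smul_tmul']
      rw [Fintype.sum_sigma]
      simp only [← TensorProduct.sum_tmul, Module.Basis.coord_apply, ← map_smul]
      rw [TensorProduct.sum_tmul]
      conv_rhs => rw [eq_sum_ofDegree_component hX v]
      rw [TensorProduct.sum_tmul]
      refine Finset.sum_congr rfl fun a _ ↦ ?_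
      congr 1
      rw [← map_sum (ofDegree ℂ (ComplexPoints X) (a : ℕ))]
      exact congrArg _ (by convert (β (a : ℕ)).sum_repr (cmp (a : ℕ) v))

/-! ### Degrees of contractions -/

section Contract

variable {Y Z : Type} [TopologicalSpace Y] [TopologicalSpace Z]

/-- **Contractions of a total-degree eigenvector by a homogeneous functional are homogeneous**: if
`(h ⊗ 1 + 1 ⊗ h') t = c • t` and `φ ∘ h = a • φ`, then `h' ((φ ⊗ id) t) = (c - a) • (φ ⊗ id) t`. -/
theorem degreeOperator_contract {N N' : ℕ} {t : totalCohomology ℂ Y ⊗[ℂ] totalCohomology ℂ Z} {c : ℂ}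
    (ht : ((degreeOperator ℂ Y N).rTensor (totalCohomology ℂ Z) +
      (degreeOperator ℂ Z N').lTensor (totalCohomology ℂ Y)) t = c • t)
    {φ : Module.Dual ℂ (totalCohomology ℂ Y)} {a : ℂ} (hφ : φ ∘ₗ degreeOperator ℂ Y N = a • φ) :
    degreeOperator ℂ Z N' (contract _ φ t) = (c - a) • contract _ φ t := by
  have h1 := congrArg (contract (totalCohomology ℂ Z) φ) ht
  rw [LinearMap.add_apply, map_add, contract_rTensor, contract_lTensor, hφ, map_smul] at h1
  have h2 : contract (totalCohomology ℂ Z) (a • φ) t = a • contract (totalCohomology ℂ Z) φ t := by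
    simp only [contract, LinearMap.coe_comp, Function.comp_apply, LinearMap.rTensor_smul, LinearMap.smul_apply,
      map_smul, LinearEquiv.coe_coe]
  rw [h2] at h1
  rw [sub_smul]
  exact eq_sub_of_add_eq' h1

end Contract

/-! ### Homogeneous classes of `im θ^*` -/

section Homogeneous

variable {K H : SchemeOver ℂ}

/-- **A homogeneous class in the image of a pull-back is the pull-back of a homogeneous class of the same degree**
(take the degree-`d` component of any preimage). -/
theorem exists_totalPullback_ofDegree_eq_of_mem_range (f : K ⟶ H) {d : ℕ} (y : complexBetti K d)
    (hy : ofDegree ℂ (ComplexPoints K) d y ∈ LinearMap.range (totalPullback ℂ (AlgPoints.mapContinuous (L := ℂ) f))) :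
    ∃ w : complexBetti H d, totalPullback ℂ (AlgPoints.mapContinuous (L := ℂ) f) (ofDegree ℂ (ComplexPoints H) d w) =
      ofDegree ℂ (ComplexPoints K) d y := by
  classical
  obtain ⟨v, hv⟩ := hy
  refine ⟨DirectSum.component ℂ ℕ (fun i ↦ (complexBetti H i : Type)) d v, ?_⟩
  rw [totalPullback_lof, ← component_totalPullback, hv,
    DirectSum.component.lof_self (R := ℂ) (M := fun i ↦ (complexBetti K i : Type))]

end Homogeneous

/-! ### `Θ^*(Hᵏ) ⊆ κ(H*(A) ⊗ R_{≤ k})` -/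

section Main

variable {A : AbelianVariety ℂ} {K H : SchemeOver ℂ} {n k₀ : ℕ} {Ξ : (A.X ⊗ H).left.IdealSheafData}
  {act : A.X ⊗ H ⟶ H} {j : K ⟶ H}
  {G : Type} [Group G] [Fintype G] [MulAction G (ComplexPoints (A.X ⊗ K))]
  (c : FiniteDeckCover G (ComplexPoints (A.X ⊗ K)) (ComplexPoints H))
  (hc : c.proj = AlgPoints.mapContinuous (L := ℂ) (kummerCover act j))
  (hdeck : ∀ g : G, ∃ (b : 𝟙_ (SchemeOver ℂ) ⟶ A.X) (τ : K ⟶ K),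
    c.deck g = AlgPoints.mapContinuous (L := ℂ) (A.translate b⁻¹ ⊗ₘ τ))
  (hS : IsSmoothProjective 2 A.X) (hK : IsSmoothProjective (2 * n) K) (hH : IsHilbertSchemeOfPoints k₀ A.X H Ξ)
  (hact : IsTranslationAction Ξ act)

include c hc hdeck hS hK hH hact in
/-- **`Θ^*` of a class of degree `k` lies in `κ(H*(A) ⊗ S)` for every submodule `S ⊆ H*(K)` containing `θ^*(Hᵈ(H))`
for all `d ≤ k`.**  Proof: `t = κ⁻¹ Θ^* z ∈ H*(A) ⊗ R` is an eigenvector of the total degree operator; expand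
`t = Σᵢ bᵢ ⊗ (bᵢ^* ⊗ id) t` in a homogeneous basis of `H*(A)`: each `sᵢ = (bᵢ^* ⊗ id) t` lies in `R` (dual-functional
criterion) and is homogeneous of degree `k - deg bᵢ ≤ k` (or `0`), hence is `θ^*` of a class of that degree. -/
theorem totalPullback_ofDegree_mem_map_tensorWith {k : ℕ} (z : complexBetti H k)
    (S : Submodule ℂ (totalCohomology ℂ (ComplexPoints K)))
    (hSk : ∀ d ≤ k, ∀ w : complexBetti H d,
      totalPullback ℂ (AlgPoints.mapContinuous (L := ℂ) j) (ofDegree ℂ (ComplexPoints H) d w) ∈ S) :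
    totalPullback ℂ (AlgPoints.mapContinuous (L := ℂ) (kummerCover act j)) (ofDegree ℂ (ComplexPoints H) k z) ∈
      (tensorWith (totalCohomology ℂ (ComplexPoints A.X)) S).map (kunnethCross A.X K) := by
  classical
  haveI := finite_totalCohomology hS
  set κ := kunnethEquiv hS hK with hκ
  set v := totalPullback ℂ (AlgPoints.mapContinuous (L := ℂ) (kummerCover act j)) (ofDegree ℂ (ComplexPoints H) k z)
    with hv
  set t := κ.symm v with ht
  have hκt : kunnethCross A.X K t = v := by rw [ht, ← kunnethEquiv_apply hS hK, LinearEquiv.apply_symm_apply]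
  -- `t ∈ H*(A) ⊗ R`
  have htR : t ∈ tensorWith (totalCohomology ℂ (ComplexPoints A.X)) (fibreRange A K (kummerCover act j)) :=
    kunnethEquiv_symm_mem_tensorWith c hc hdeck hS hK ⟨_, rfl⟩
  -- `t` is an eigenvector of the total degree operator for `k - (2 + 2n)`
  have hdeg : ((degreeOperator ℂ (ComplexPoints A.X) 2).rTensor (totalCohomology ℂ (ComplexPoints K)) +
      (degreeOperator ℂ (ComplexPoints K) (2 * n)).lTensor (totalCohomology ℂ (ComplexPoints A.X))) t =
      (((k : ℂ) - ((2 + 2 * n : ℕ) : ℂ))) • t := by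
    apply (kunnethCross_bijective hS hK).1
    rw [← LinearMap.comp_apply, ← degreeOperator_comp_totalCross, LinearMap.comp_apply, map_smul, hκt, hv,
      degreeOperator_totalPullback, degreeOperator_lof, map_smul]
  -- expand `t` along homogeneous classes of `H*(A)`
  obtain ⟨I, _, b, φ, deg, hb, hcoord, hexp⟩ :=
    exists_homogeneous_expansion hS 2 (totalCohomology ℂ (ComplexPoints K))
  rw [← hκt, ← hexp t, map_sum]
  refine Submodule.sum_mem _ fun i _ ↦ Submodule.mem_map_of_mem (tmul_mem_tensorWith _ ?_)
  -- the contraction `sᵢ` is in `R` and homogeneous of degree `k - deg i`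
  set s := contract (totalCohomology ℂ (ComplexPoints K)) (φ i) t with hs
  have hsR : s ∈ fibreRange A K (kummerCover act j) := contract_mem_of_mem_tensorWith _ htR
  have hsdeg : degreeOperator ℂ (ComplexPoints K) (2 * n) s =
      ((((k : ℂ) - ((2 + 2 * n : ℕ) : ℂ))) - (((deg i : ℂ) - (2 : ℕ)))) • s :=
    degreeOperator_contract hdeg (hcoord i)
  have hsmem : s ∈ degreeSpace (degreeOperator ℂ (ComplexPoints K) (2 * n)) ((k : ℤ) - deg i - (2 * n : ℕ)) := by
    rw [Literature.Algebra.Lie.mem_degreeSpace_iff, hsdeg]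
    congr 1
    push_cast
    ring
  rw [fibreRange_eq_range c hc hdeck hS hK hH hact] at hsR
  by_cases hik : deg i ≤ k
  · rw [degreeSpace_degreeOperator_eq_range (2 * n) (k - deg i) (by push_cast [Nat.cast_sub hik]; ring)] at hsmem
    obtain ⟨y, hy⟩ := hsmem
    obtain ⟨w, hw⟩ := exists_totalPullback_ofDegree_eq_of_mem_range j y (hy ▸ hsR)
    rw [← hy, ← hw]
    exact hSk (k - deg i) (Nat.sub_le k (deg i)) w
  · rw [degreeSpace_degreeOperator_eq_bot (2 * n) (by push_cast; omega), Submodule.mem_bot] at hsmem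
    rw [hsmem]
    exact S.zero_mem

end Main

end Summit.Ventures.HodgeKum4.HilbertKummer

end
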